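import Summits.RiemannHypothesis.RiemannHypothesis.Theorems.SemilocalNegCertFiftyThreeKinked2044
import HarnessLib

/-!
# Semi-local threshold of the `{∞,2,…,53}` form, negative side: `a*({2,…,53}) ≤ 2093 / 1024 = 2.0439453125` — the wall `q = 59` from a KINKED (piecewise-cubic) witness with slope breaks at the odd-prime-atom images (part 15/21: the kernel facts piece 199 … piece 212 of 269 (imports part 1 only))

Cell `rh-explicit` (HOME `run/shared/lean/pub/rh-explicit/`), seat cc-s2-9 gen2 (HUMAN RULING D-0074 (D5) WEIL data engine; LADDER-RH column WEIL, rung DATA → W-P(P2);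
pipeline = cc-s2-4 gen8/gen11's piecewise-witness layer `SemilocalPiecewise{Witness,Increment,IncrementSum,Cert}.lean` + their float finder, every number
re-derived by an independent second engine E2 before filing; gen0's rows: `SemilocalNegCert{ThirteenKinked1423,SeventeenKinked1478,NineteenKinked1573,TwentyThreeKinked1690,TwentyNineKinked1723}*`).
HONEST FRAMING: RH-FREE theorems about the tree's `weilSemilocalThreshold S` of a TRUNCATED Weil form (finitely many places); nothing here bears on the
truth of RH; the lower clause `(log q)/2 ≤ a*(S_q)` at all primes IS RH and is untouched; the SIGN of `δ*(59)` is not claimed.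

KINKED row for the wall `q = 59` (`S = {2,…,53}`): at `b = 2093 / 1024 = 2.0439453125 ≈ a*(S_59) + 0.0051` (DATA, two engines, cc-s2-6/cc-s2-3: `a*(S_59) = 2.0388`)
the polynomial × indicator class is far from negative (tree row `263/128`, `SemilocalNegCertUptoFiftyThree`, `δ*(59) ≤ 0.0159`), whereas an odd piecewise cubic with slope breaks at the images
`|b − log n|` (rounded to `/1024`) of the atoms `n ∈ {3,5,7,11,13,17,19,23,29,31,37,41,43,47,53}` (the fifteen ODD-PRIME atoms; images of 2 and of the prime powers dropped — with 2 added λ_min = −2.10·10⁻³, with 2, 4, 9 added −4.53·10⁻³; kit j253429) is negative by `1.825e-03·‖G‖²`.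
Instance: `S = {2, 3, 5, 7, 11, 13, 17, 19, 23, 29, 31, 37, 41, 43, 47, 53}`, `N = 62` (atom table `atomsUptoFiftyThree` / `atomsEnclose_UptoFiftyThree` of `SemilocalNegCertUptoFiftyThree.lean`), 16 pieces of degree ≤ 3, 269 `t`-pieces;
TWO ENGINES on the witness before the kernel: cc-s2-4's float finder `λ_min = -1.8248e-03` and the seat's exact-in-`x` decimal engine E2 `R = -1.8239e-03` (no polar credit);
the exact kernel margin is the certificate's own rational arithmetic (farm report).  ⇒ **`a*({2,…,53}) ≤ 2093 / 1024`, `δ*(59) < 0.005177`** (was `0.0159`).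
No data is trusted: every bound is a `decide +kernel` fact.  Folklore throughout.
-/

set_option autoImplicit false
set_option linter.dupNamespace false  -- the mandated namespace repeats `RiemannHypothesis`
set_option Elab.async false  -- serialise the kernel facts: in parallel they exhaust the node's per-process heap (cc-s2-4 gen11, CC4-LEAN §16.10)

noncomputable section

open Complex Filter Set MeasureTheory Topology
open scoped Real

namespace Summit.RiemannHypothesis.RiemannHypothesis.Theorems.SemilocalPolyWitness

open MeasureTheory Set Finset Real
open Literature.NumberTheory.LFunctions
open Summit.RiemannHypothesis.RiemannHypothesis.Theorems.MotivicDoor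
open Summit.RiemannHypothesis.RiemannHypothesis.Theorems.MotivicDoor.SemilocalThreshold
open Summit.RiemannHypothesis.RiemannHypothesis.Theorems.MotivicDoor.SemilocalMarkov
open LQ

set_option maxHeartbeats 0 in
/-- kernel fact: piece `199` of `certFiftyThreeKinked2044`. -/
theorem check_FiftyThreeKinked2044_piece199 : certFiftyThreeKinked2044.checkPiecePW 199 = true := by
  decide +kernel

set_option maxHeartbeats 0 in
/-- kernel fact: piece `200` of `certFiftyThreeKinked2044`. -/
theorem check_FiftyThreeKinked2044_piece200 : certFiftyThreeKinked2044.checkPiecePW 200 = true := by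
  decide +kernel

set_option maxHeartbeats 0 in
/-- kernel fact: piece `201` of `certFiftyThreeKinked2044`. -/
theorem check_FiftyThreeKinked2044_piece201 : certFiftyThreeKinked2044.checkPiecePW 201 = true := by
  decide +kernel

set_option maxHeartbeats 0 in
/-- kernel fact: piece `202` of `certFiftyThreeKinked2044`. -/
theorem check_FiftyThreeKinked2044_piece202 : certFiftyThreeKinked2044.checkPiecePW 202 = true := by
  decide +kernel

set_option maxHeartbeats 0 in
/-- kernel fact: piece `203` of `certFiftyThreeKinked2044`. -/
theorem check_FiftyThreeKinked2044_piece203 : certFiftyThreeKinked2044.checkPiecePW 203 = true := by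
  decide +kernel

set_option maxHeartbeats 0 in
/-- kernel fact: piece `204` of `certFiftyThreeKinked2044`. -/
theorem check_FiftyThreeKinked2044_piece204 : certFiftyThreeKinked2044.checkPiecePW 204 = true := by
  decide +kernel

set_option maxHeartbeats 0 in
/-- kernel fact: piece `205` of `certFiftyThreeKinked2044`. -/
theorem check_FiftyThreeKinked2044_piece205 : certFiftyThreeKinked2044.checkPiecePW 205 = true := by
  decide +kernel

set_option maxHeartbeats 0 in
/-- kernel fact: piece `206` of `certFiftyThreeKinked2044`. -/
theorem check_FiftyThreeKinked2044_piece206 : certFiftyThreeKinked2044.checkPiecePW 206 = true := by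
  decide +kernel

set_option maxHeartbeats 0 in
/-- kernel fact: piece `207` of `certFiftyThreeKinked2044`. -/
theorem check_FiftyThreeKinked2044_piece207 : certFiftyThreeKinked2044.checkPiecePW 207 = true := by
  decide +kernel

set_option maxHeartbeats 0 in
/-- kernel fact: piece `208` of `certFiftyThreeKinked2044`. -/
theorem check_FiftyThreeKinked2044_piece208 : certFiftyThreeKinked2044.checkPiecePW 208 = true := by
  decide +kernel

set_option maxHeartbeats 0 in
/-- kernel fact: piece `209` of `certFiftyThreeKinked2044`. -/
theorem check_FiftyThreeKinked2044_piece209 : certFiftyThreeKinked2044.checkPiecePW 209 = true := by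
  decide +kernel

set_option maxHeartbeats 0 in
/-- kernel fact: piece `210` of `certFiftyThreeKinked2044`. -/
theorem check_FiftyThreeKinked2044_piece210 : certFiftyThreeKinked2044.checkPiecePW 210 = true := by
  decide +kernel

set_option maxHeartbeats 0 in
/-- kernel fact: piece `211` of `certFiftyThreeKinked2044`. -/
theorem check_FiftyThreeKinked2044_piece211 : certFiftyThreeKinked2044.checkPiecePW 211 = true := by
  decide +kernel

set_option maxHeartbeats 0 in
/-- kernel fact: piece `212` of `certFiftyThreeKinked2044`. -/
theorem check_FiftyThreeKinked2044_piece212 : certFiftyThreeKinked2044.checkPiecePW 212 = true := by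
  decide +kernel

end Summit.RiemannHypothesis.RiemannHypothesis.Theorems.SemilocalPolyWitness

end
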